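import Literature.NumberTheory.Automorphic.RankinSelbergTorusEulerLimit
import HarnessLib

/-!
# The unfolded Rankin–Selberg integral of a PAIR at a complex point: the exact Euler factorisation and
the unramified factor `det(1 - q_v^{-s} A ⊗ B)⁻¹` (Cauchy's identity for two alphabets)

Topic `NumberTheory/Automorphic`; namespace `Literature.NumberTheory.Automorphic`. Definitions + theorems.
`RankinSelbergTorusIntegralComplex` treats the unfolded global Rankin–Selberg integral of ONE Whittaker
function against its conjugate, `Ψ(s; W, W̄, Φ) = ∫ |W|² Φ(e_n ·) |det a|^s δ_B⁻¹`, at a complex point: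
translation by `ϖ_v^μ` at a good place multiplies the integrand by `|s_μ(x)|² q_v^{-s|μ|}`, whence the
exact Euler factorisation with the factors `T_v(q_v^{-s}) = ∑_μ |s_μ(x)|² q_v^{-s|μ|} = det(1 - q_v^{-s} A ⊗ Ā)⁻¹`
(Cauchy's identity at `y = x̄`). The printed theory (Jacquet–Shalika (1981), §2, Prop. (2.3) and §4;
Cogdell (2004), Thm. 2.2 with Thm. 3.3: "`Ψ(s; W°_v, W'°_v, Φ°_v) = det(I - q_v^{-s} A_{π_v} ⊗ A_{π'_v})⁻¹`")
is for a PAIR `(W, W')` of Whittaker functions of two representations `π_v`, `π'_v` with Satake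
parameters `x`, `y` — the input of every statement on `L(s, π × π')` with `π' ≇ π̃` (Cogdell, Thm. 4.2;
Arthur–Clozel (1989), Ch. 3, (2.2); Mœglin–Waldspurger (1989), Appendice, Corollaire (i)). This file is
the pair version, with the same proofs:

* `torusPairIntegrandC W W' Φ s (a, k) = W(diag(a) k) W'(diag(a) k) Φ(e_n diag(a) k) |det a|^s δ_B(a)⁻¹`,
  `rankinSelbergTorusPairIntegralC νA νK W W' Φ s` (**definitions**; `‖·‖ ≤ ½ (|W|² + |W'|²) |Φ| w_{re s}`,
  `norm_torusPairIntegrandC_le`, so the pair integrand is integrable when the two real integrals at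
  `re s` are finite, `integrable_torusPairIntegrandC`); `continuous_torusWeightC`, `measurable_torusIntegrandC`,
  `measurable_torusPairIntegrandC` (the measurability both complex files take as a hypothesis),
  `torusPairIntegrandC_ofReal` (at a real point: `W W' (Φ w_σ)`);
* `localPairCoeffC v x y s μ = s_μ(x) s_μ(y) q_v^{-s|μ|}`, `torusPairSumC v x y s = ∑_μ localPairCoeffC`
  (**definitions**; absolutely convergent when the two real torus sums at `re s` are finite,
  `summable_localPairCoeffC`, by `|s_μ(x) s_μ(y)| ≤ ½ (|s_μ(x)|² + |s_μ(y)|²)`);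
* `IsTorusUnramifiedAt.of_valued_eq` — change of uniformizer (so that the Whittaker functions of a pair,
  each unramified at `v` for its own uniformizer, have a common one); `piPowGL_mem_glInt_of_valued_eq_one`;
  `IsTorusUnramifiedAt.star` — conjugation (`W̄` has the conjugate parameters; `conj_schurTrunc`);
* `torusPairIntegrandC_localTorusPow_mul` — **the translation law**: for `W`, `W'` unramified
  Whittaker–Hecke data at `v` with parameters `x`, `y` (`IsTorusUnramifiedAt`) and `Φ` spherical at `v`,
  `I_s(ϖ^μ a, k) = s_μ(x) s_μ(y) q_v^{-s|μ|} I_s(a, k)` on the unit box at `v` (Shintani's formula for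
  each factor contributes `q_v^{-b(μ)/2} s_μ`, the complex Jacobian `q_v^{b(μ) - s|μ|}`);
* `setIntegral_smul_unitBox_pair_eqC`, `torusPairIntegrandC_eq_zero_of_not_mem_iUnion` (the pair integrand
  vanishes where the real integrand of `W` does: off the translates of the unit box),
  `hasSum_localPairCoeffC_mul_setIntegral`, `torusPairSumC_mul_setIntegral_eq`,
  `prod_torusPairSumC_mul_setIntegral_eq`, `prod_torusPairSumC_mul_setIntegral_eq_rankinSelbergTorusPairIntegralC`
  — **the exact Euler factorisation over a finite set of good places**,
  `(∏_{v ∈ F} T_v) · ∫_{B(F) × K} I_s = Ψ(s; W, W', Φ)`;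
* `hasSum_schurTrunc_mul_schurTrunc_mul_pow`, `torusPairSumC_eq_prod_inv`,
  `torusPairSumC_eq_inv_eval_satakePairPolynomial` — **the unramified factor in closed form**:
  `T_v(q_v^{-s}) = ∑_μ s_μ(x) s_μ(y) q_v^{-s|μ|} = ∏_{i,j} (1 - x_i y_j q_v^{-s})⁻¹ = (P_{α,β}(q_v^{-s}))⁻¹`,
  the local factor of `partialPairL` for the Satake multisets `α`, `β` enumerated by `x`, `y` (Cauchy's
  identity for two alphabets, `hasSum_shintaniPair`; Macdonald, Ch. I (4.3));
* `tendsto_setIntegral_unitBox_image_pair`, `rankinSelbergTorusPairIntegralC_eq_mul_setIntegral_of_hasProd`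
  — **all good places**: `Ψ(s; W, W', Φ) = L · ∫_{B({v ∉ S'}) × K} I_s` whenever the unramified local factors
  `P_{α_v,β_v}(q_v^{-s})⁻¹`, `v ∉ S'`, have the product `L` (for Satake families of two cuspidal
  representations and `re s > 1`: `L = partialPairL S' α β s`, `hasProd_partialPairL`) — the Euler
  factorisation `Ψ(s; W, W', Φ) = L^{S'}(s, π × π') · Ψ_{S'}(s)` (as `RankinSelbergTorusEulerLimit`).

## References

* H. Jacquet, J. A. Shalika, *On Euler products and the classification of automorphic
  representations I*, Amer. J. Math. 103 (1981), §2 Prop. (2.3), §4 [JacquetShalikaAJM1981].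
* J. W. Cogdell, *Analytic theory of L-functions for GL_n*, in *An Introduction to the Langlands
  Program* (2004), §2.3 Thm. 2.2, §3 Thm. 3.3 [CogdellAnalyticTheory2004].
* I. G. Macdonald, *Symmetric Functions and Hall Polynomials*, 2nd ed. (1995), Ch. I (4.3) [Macdonald1995].
-/

noncomputable section

open MeasureTheory Measure NumberField IsDedekindDomain Matrix Set Filter Finset Topology
open scoped MatrixGroups ENNReal NNReal ComplexConjugate Pointwise
open Literature.RingTheory.SymmetricFunctions.SymmPoly
open Literature.NumberTheory.GaloisRepresentations (ideleGroup localUnits)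

namespace Literature.NumberTheory.Automorphic

/-! ### The complex pair integrand and the Bochner pair integral -/

section Integrand

variable (n : ℕ) (K : Type) [Field K] [NumberField K]

/-- The **integrand of the unfolded Rankin–Selberg integral of a pair at a complex point** in torus
coordinates: `(a, k) ↦ W(diag(a) k) W'(diag(a) k) Φ(e_n diag(a) k) |det a|^s δ_B(a)⁻¹ ∈ ℂ`
(Cogdell (2004), §2.3, the integrand of `Ψ(s; W_φ, W'_{φ'}, Φ)` after the Iwasawa decomposition).
[cite: CogdellAnalyticTheory2004, §2.3 Thm. 2.2] -/
def torusPairIntegrandC (W W' : GL (Fin n) (AdeleRing (𝓞 K) K) → ℂ) (Φ : (Fin n → AdeleRing (𝓞 K) K) → ℝ)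
    (s : ℂ) (p : (Fin n → ideleGroup K) × ↥(maximalCompactAdelic n K)) : ℂ :=
  W (torusPoint n K p) * W' (torusPoint n K p) * (Φ (lastRow n K (torusPoint n K p)) : ℂ) *
    torusWeightC n K s p.1

variable [MeasurableSpace (ideleGroup K)] [MeasurableSpace (AdelicGroupData.gl n K).Adelic]

/-- **The unfolded Rankin–Selberg integral of a pair of Whittaker functions at a complex point `s`**:
`Ψ(s; W, W', Φ) = ∫_{(𝔸ˣ)ⁿ × K} W(diag(a) k) W'(diag(a) k) Φ(e_n diag(a) k) |det a|^s δ_B(a)⁻¹ dνA dνK`,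
a Bochner integral (value `0` when not integrable; integrable when the real integrals of `W` and `W'` at
`re s` are finite, `integrable_torusPairIntegrandC`). This is `Ψ(s; W, W', Φ)` of Jacquet–Shalika (1981),
§4, (4.4) / Cogdell (2004), Thm. 2.1–2.2, with `W'` in the part of the `ψ⁻¹`-Whittaker function, written
through the Iwasawa decomposition. [cite: CogdellAnalyticTheory2004, §2.3 Thm. 2.2] -/
def rankinSelbergTorusPairIntegralC (νA : Measure (Fin n → ideleGroup K))
    (νK : Measure ↥(maximalCompactAdelic n K)) (W W' : GL (Fin n) (AdeleRing (𝓞 K) K) → ℂ)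
    (Φ : (Fin n → AdeleRing (𝓞 K) K) → ℝ) (s : ℂ) : ℂ :=
  ∫ p, torusPairIntegrandC n K W W' Φ s p ∂(νA.prod νK)

variable {n K}
variable {W W' : GL (Fin n) (AdeleRing (𝓞 K) K) → ℂ} {Φ : (Fin n → AdeleRing (𝓞 K) K) → ℝ}

omit [MeasurableSpace (ideleGroup K)] [MeasurableSpace (AdelicGroupData.gl n K).Adelic] in
/-- **The modulus of the pair integrand**: `‖I_s(a, k)‖ = |W| |W'| |Φ| · |det a|^{re s} δ_B(a)⁻¹`. [folklore] -/
theorem norm_torusPairIntegrandC (s : ℂ) (p : (Fin n → ideleGroup K) × ↥(maximalCompactAdelic n K)) :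
    ‖torusPairIntegrandC n K W W' Φ s p‖ =
      ‖W (torusPoint n K p)‖ * ‖W' (torusPoint n K p)‖ * |Φ (lastRow n K (torusPoint n K p))| *
        torusWeight n K s.re p.1 := by
  rw [torusPairIntegrandC, norm_mul, norm_mul, norm_mul, norm_torusWeightC, Complex.norm_real, Real.norm_eq_abs]

omit [MeasurableSpace (ideleGroup K)] [MeasurableSpace (AdelicGroupData.gl n K).Adelic] in
/-- **The pair integrand is dominated by the mean of the two real integrands at `re s`** (`Φ ≥ 0`):
`‖I_s(W, W')‖ ≤ ½ (I_{re s}(W) + I_{re s}(W'))`, from `|W W'| ≤ ½ (|W|² + |W'|²)`. [folklore] -/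
theorem norm_torusPairIntegrandC_le (hΦ : ∀ y, 0 ≤ Φ y) (s : ℂ)
    (p : (Fin n → ideleGroup K) × ↥(maximalCompactAdelic n K)) :
    ‖torusPairIntegrandC n K W W' Φ s p‖ ≤
      ((torusIntegrand n K W Φ s.re p).toReal + (torusIntegrand n K W' Φ s.re p).toReal) / 2 := by
  have hw : 0 ≤ Φ (lastRow n K (torusPoint n K p)) * torusWeight n K s.re p.1 :=
    mul_nonneg (hΦ _) (torusWeight_nonneg s.re p.1)
  rw [norm_torusPairIntegrandC, abs_of_nonneg (hΦ _), torusIntegrand, torusIntegrand,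
    ENNReal.toReal_ofReal (mul_nonneg (mul_nonneg (sq_nonneg _) (hΦ _)) (torusWeight_nonneg s.re p.1)),
    ENNReal.toReal_ofReal (mul_nonneg (mul_nonneg (sq_nonneg _) (hΦ _)) (torusWeight_nonneg s.re p.1))]
  nlinarith [two_mul_le_add_sq ‖W (torusPoint n K p)‖ ‖W' (torusPoint n K p)‖,
    mul_nonneg (mul_nonneg (norm_nonneg (W (torusPoint n K p))) (norm_nonneg (W' (torusPoint n K p)))) hw,
    sq_nonneg ‖W (torusPoint n K p)‖, sq_nonneg ‖W' (torusPoint n K p)‖]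

/-- **Integrability of the pair integrand** from finiteness of the two real torus integrals at `re s`
(for `Φ ≥ 0`, an a.e. strongly measurable pair integrand and measurable real integrands). [folklore] -/
theorem integrable_torusPairIntegrandC (νA : Measure (Fin n → ideleGroup K))
    (νK : Measure ↥(maximalCompactAdelic n K)) (hΦ : ∀ y, 0 ≤ Φ y) {s : ℂ}
    (hm : AEStronglyMeasurable (torusPairIntegrandC n K W W' Φ s) (νA.prod νK))
    (hmW : Measurable (torusIntegrand n K W Φ s.re)) (hmW' : Measurable (torusIntegrand n K W' Φ s.re))
    (hfin : rankinSelbergTorusIntegral n K νA νK W Φ s.re ≠ ⊤)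
    (hfin' : rankinSelbergTorusIntegral n K νA νK W' Φ s.re ≠ ⊤) :
    Integrable (torusPairIntegrandC n K W W' Φ s) (νA.prod νK) :=
  Integrable.mono' (((integrable_toReal_of_lintegral_ne_top hmW.aemeasurable hfin).add
    (integrable_toReal_of_lintegral_ne_top hmW'.aemeasurable hfin')).div_const 2) hm
    (Eventually.of_forall fun p => norm_torusPairIntegrandC_le hΦ s p)

end Integrand

/-! ### Continuity of the complex torus weight; measurability of the integrands -/

section Measurability

variable {n : ℕ} {K : Type} [Field K] [NumberField K]

/-- **The complex torus weight `a ↦ |det a|^s δ_B(a)⁻¹` is continuous** (each factor is `z ↦ z^{s - d}`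
at the positive real `‖a_i‖`, a point of the slit plane, composed with the continuous idele norm).
[folklore] -/
theorem continuous_torusWeightC (s : ℂ) : Continuous (torusWeightC n K s) := by
  unfold torusWeightC
  refine continuous_finsetProd _ fun i _ => ?_
  have hc : Continuous fun a : Fin n → ideleGroup K => ((((IdeleClassGroup.ideleNorm K (a i) : ℝ≥0) : ℝ)) : ℂ) :=
    Complex.continuous_ofReal.comp (NNReal.continuous_coe.comp ((continuous_ideleNorm_holds K).comp (continuous_apply i)))
  refine continuous_iff_continuousAt.2 fun a => ?_
  have h2 : ContinuousAt (fun z : ℂ => z ^ (s - ((((n : ℝ) - 1 - 2 * (i : ℕ) : ℝ)) : ℂ)))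
      ((((IdeleClassGroup.ideleNorm K (a i) : ℝ≥0) : ℝ)) : ℂ) :=
    continuousAt_cpow_const (Complex.ofReal_mem_slitPlane.2 (ideleNorm_coe_pos K (a i)))
  exact ContinuousAt.comp (g := fun z : ℂ => z ^ (s - ((((n : ℝ) - 1 - 2 * (i : ℕ) : ℝ)) : ℂ))) h2 hc.continuousAt

/-- At a real point the pair integrand is `W W' · (Φ w_σ)` with the real torus weight. [folklore] -/
theorem torusPairIntegrandC_ofReal {W W' : GL (Fin n) (AdeleRing (𝓞 K) K) → ℂ} {Φ : (Fin n → AdeleRing (𝓞 K) K) → ℝ}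
    (σ : ℝ) (p : (Fin n → ideleGroup K) × ↥(maximalCompactAdelic n K)) :
    torusPairIntegrandC n K W W' Φ (σ : ℂ) p =
      W (torusPoint n K p) * W' (torusPoint n K p) *
        ((Φ (lastRow n K (torusPoint n K p)) * torusWeight n K σ p.1 : ℝ) : ℂ) := by
  rw [torusPairIntegrandC, torusWeightC_ofReal, Complex.ofReal_mul, mul_assoc]

variable [MeasurableSpace (ideleGroup K)] [BorelSpace (ideleGroup K)] [MeasurableSpace (AdelicGroupData.gl n K).Adelic]

attribute [local instance] secondCountableTopology_ideleGroup

/-- **Measurability of the complex one-function integrand** `I_s = |W|² Φ(e_n ·) w_s` from the measurability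
of `p ↦ W(diag(a) k)` and `p ↦ Φ(e_n diag(a) k)` on the torus × compact coordinates (for continuous `W`
these follow from `continuous_torusPoint` under the house Borel structures). [folklore] -/
theorem measurable_torusIntegrandC {W : GL (Fin n) (AdeleRing (𝓞 K) K) → ℂ} {Φ : (Fin n → AdeleRing (𝓞 K) K) → ℝ}
    (hWm : Measurable fun p : (Fin n → ideleGroup K) × ↥(maximalCompactAdelic n K) => W (torusPoint n K p))
    (hΦm : Measurable fun p : (Fin n → ideleGroup K) × ↥(maximalCompactAdelic n K) => Φ (lastRow n K (torusPoint n K p)))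
    (s : ℂ) : Measurable (torusIntegrandC n K W Φ s) := by
  unfold torusIntegrandC
  exact (Complex.measurable_ofReal.comp ((hWm.norm.pow_const 2).mul hΦm)).mul
    ((continuous_torusWeightC s).measurable.comp measurable_fst)

/-- **Measurability of the complex pair integrand** `I_s = W W' Φ(e_n ·) w_s`, likewise. [folklore] -/
theorem measurable_torusPairIntegrandC {W W' : GL (Fin n) (AdeleRing (𝓞 K) K) → ℂ} {Φ : (Fin n → AdeleRing (𝓞 K) K) → ℝ}
    (hWm : Measurable fun p : (Fin n → ideleGroup K) × ↥(maximalCompactAdelic n K) => W (torusPoint n K p))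
    (hW'm : Measurable fun p : (Fin n → ideleGroup K) × ↥(maximalCompactAdelic n K) => W' (torusPoint n K p))
    (hΦm : Measurable fun p : (Fin n → ideleGroup K) × ↥(maximalCompactAdelic n K) => Φ (lastRow n K (torusPoint n K p)))
    (s : ℂ) : Measurable (torusPairIntegrandC n K W W' Φ s) := by
  unfold torusPairIntegrandC
  exact ((hWm.mul hW'm).mul (Complex.measurable_ofReal.comp hΦm)).mul
    ((continuous_torusWeightC s).measurable.comp measurable_fst)

end Measurability

/-! ### The local pair coefficient and the translation law -/

section Translation

variable {n : ℕ} {K : Type} [Field K] [NumberField K] {v : HeightOneSpectrum (𝓞 K)}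
  {ϖ : (v.adicCompletion K)ˣ} {x y : Fin n → ℂ}
  {W W' : GL (Fin n) (AdeleRing (𝓞 K) K) → ℂ} {Φ : (Fin n → AdeleRing (𝓞 K) K) → ℝ}

/-- The **complex local Rankin–Selberg coefficient of a pair** `s_μ(x) s_μ(y) q_v^{-s|μ|}` — the term of
the torus sum `T_v(q_v^{-s})` of the pair indexed by the weight `μ`. [folklore] -/
def localPairCoeffC (v : HeightOneSpectrum (𝓞 K)) (x y : Fin n → ℂ) (s : ℂ) (mu : Fin n → ℕ) : ℂ :=
  schurTrunc x mu * schurTrunc y mu * (v.residueCard : ℂ) ^ (-(s * ∑ i, (mu i : ℂ)))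

/-- `‖s_μ(x) s_μ(y) q^{-s|μ|}‖ ≤ ½ (‖|s_μ(x)|² q^{-s|μ|}‖ + ‖|s_μ(y)|² q^{-s|μ|}‖)`. [folklore] -/
theorem norm_localPairCoeffC_le (v : HeightOneSpectrum (𝓞 K)) (x y : Fin n → ℂ) (s : ℂ) (mu : Fin n → ℕ) :
    ‖localPairCoeffC v x y s mu‖ ≤ (‖localCoeffC v x s mu‖ + ‖localCoeffC v y s mu‖) / 2 := by
  rw [localPairCoeffC, localCoeffC, localCoeffC, norm_mul, norm_mul, norm_mul, norm_mul, Complex.norm_real,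
    Complex.norm_real, Real.norm_of_nonneg (sq_nonneg _), Real.norm_of_nonneg (sq_nonneg _)]
  nlinarith [two_mul_le_add_sq ‖schurTrunc x mu‖ ‖schurTrunc y mu‖,
    norm_nonneg ((v.residueCard : ℂ) ^ (-(s * ∑ i, (mu i : ℂ)))),
    mul_nonneg (mul_nonneg (norm_nonneg (schurTrunc x mu)) (norm_nonneg (schurTrunc y mu)))
      (norm_nonneg ((v.residueCard : ℂ) ^ (-(s * ∑ i, (mu i : ℂ)))))]

open ValuativeRel in
/-- A diagonal matrix of unit powers `diag(u^{μ_i})`, `|u|_v = 1`, lies in `GL_n(𝒪_v)`. [folklore] -/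
theorem piPowGL_mem_glInt_of_valued_eq_one {u : (v.adicCompletion K)ˣ} (hu : Valued.v (u : v.adicCompletion K) = 1)
    (mu : Fin n → ℕ) : piPowGL u.ne_zero mu ∈ glInt n (v.adicCompletion K) := by
  have hentry : ∀ (w : (v.adicCompletion K)ˣ), Valued.v (w : v.adicCompletion K) = 1 → ∀ i j,
      ((piPowGL w.ne_zero mu : GL (Fin n) (v.adicCompletion K)) : Matrix (Fin n) (Fin n) (v.adicCompletion K)) i j ∈
        𝒪[v.adicCompletion K] := by
    intro w hw i j
    rw [mem_integer_adicCompletion_iff, coe_piPowGL, Echelon.piPow_apply]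
    split_ifs
    · rw [map_pow, hw, one_pow]
    · rw [map_zero]; exact zero_le
  have hinv : (piPowGL u.ne_zero mu)⁻¹ = piPowGL (u⁻¹).ne_zero mu := by
    refine inv_eq_of_mul_eq_one_right (Units.ext ?_)
    rw [Units.val_mul, coe_piPowGL, coe_piPowGL, Echelon.piPow, Echelon.piPow, Matrix.diagonal_mul_diagonal,
      Units.val_one, ← Matrix.diagonal_one]
    congr 1
    funext i
    rw [← mul_pow, Units.val_inv_eq_inv_val, mul_inv_cancel₀ u.ne_zero, one_pow]
  have hu' : Valued.v (((u⁻¹ : (v.adicCompletion K)ˣ)) : v.adicCompletion K) = 1 := by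
    rw [Units.val_inv_eq_inv_val, map_inv₀, hu, inv_one]
  rw [mem_glInt_iff]
  refine ⟨hentry u hu, fun i j => ?_⟩
  rw [hinv]
  exact hentry u⁻¹ hu' i j

/-- **Change of uniformizer**: an unramified Whittaker–Hecke datum at `v` for the uniformizer `ϖ` is one
for every other uniformizer `ϖ'` (`ϖ' = ϖ u`, `|u| = 1`: `ι_v((ϖu)^μ) g = ι_v(ϖ^μ) (g ι_v(u^μ))` for `g`
with trivial `v`-component, and `W` is right `GL_n(𝒪_v)`-invariant). Needed to give the two Whittaker
functions of a pair a common uniformizer. [folklore] -/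
theorem IsTorusUnramifiedAt.of_valued_eq (hW : IsTorusUnramifiedAt n K W v ϖ x) {ϖ' : (v.adicCompletion K)ˣ}
    (hϖ' : Valued.v (ϖ' : v.adicCompletion K) = WithZero.exp (-1 : ℤ)) : IsTorusUnramifiedAt n K W v ϖ' x where
  valued_eq := hϖ'
  spherical := hW.spherical
  shintani g hg mu := by
    set u : (v.adicCompletion K)ˣ := ϖ⁻¹ * ϖ' with hudef
    have hu : Valued.v (u : v.adicCompletion K) = 1 := by
      rw [hudef, Units.val_mul, Units.val_inv_eq_inv_val, map_mul, map_inv₀, hW.valued_eq, hϖ',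
        inv_mul_cancel₀ WithZero.exp_ne_zero]
    have hfac : piPowGL ϖ'.ne_zero mu = piPowGL ϖ.ne_zero mu * piPowGL u.ne_zero mu := by
      refine Units.ext ?_
      rw [Units.val_mul, coe_piPowGL, coe_piPowGL, coe_piPowGL, Echelon.piPow, Echelon.piPow, Echelon.piPow,
        Matrix.diagonal_mul_diagonal]
      congr 1
      funext i
      rw [← mul_pow, hudef, Units.val_mul, Units.val_inv_eq_inv_val, mul_inv_cancel_left₀ ϖ.ne_zero]
    have hk : piPowGL u.ne_zero mu ∈ glInt n (v.adicCompletion K) := piPowGL_mem_glInt_of_valued_eq_one hu mu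
    have hcomm : GLn.ofLocal n K v (piPowGL u.ne_zero mu) * g = g * GLn.ofLocal n K v (piPowGL u.ne_zero mu) :=
      GLn.ofLocal_mul_eq_mul_ofLocal_of_toLocal_eq_one _ hg
    have h2 : localComponent v (GLn.ofLocal n K v (piPowGL u.ne_zero mu)) = piPowGL u.ne_zero mu :=
      GLn.toLocal_ofLocal _
    have hg' : localComponent v (g * GLn.ofLocal n K v (piPowGL u.ne_zero mu)) ∈ glInt n (v.adicCompletion K) := by
      have : localComponent v (g * GLn.ofLocal n K v (piPowGL u.ne_zero mu)) = piPowGL u.ne_zero mu := by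
        rw [show localComponent v (g * GLn.ofLocal n K v (piPowGL u.ne_zero mu)) =
            localComponent v g * localComponent v (GLn.ofLocal n K v (piPowGL u.ne_zero mu)) from map_mul _ _ _, h2,
          show localComponent v g = 1 from hg, one_mul]
      rw [this]
      exact hk
    rw [hfac, map_mul, mul_assoc, hcomm, hW.apply_ofLocal_piPowGL_mul hg' mu, hW.spherical _ hk g]

/-- Complex conjugation of the truncated Schur polynomial: `conj s_μ(x) = s_μ(x̄)` (`map_schur`). [folklore] -/
theorem conj_schurTrunc (z : Fin n → ℂ) (mu : Fin n → ℕ) : conj (schurTrunc z mu) = schurTrunc (star z) mu := by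
  unfold schurTrunc
  split_ifs with h
  · exact map_schur (starRingEnd ℂ) z mu
  · exact map_zero _

/-- **Conjugation**: if `W` is an unramified Whittaker–Hecke datum at `v` with parameters `x`, then so is
`W̄ = star W`, with the conjugate parameters `x̄` (the Shintani factor `q^{-b/2} s_μ(x)` becomes
`q^{-b/2} s_μ(x̄)`). With `W` the `ψ`-Whittaker coefficient of a cusp form `φ̄'` of `σ̄`, `W̄` is the
`ψ̄`-Whittaker coefficient of `φ' ∈ σ` — the second Whittaker function of the pair `(π, σ)`, whose
parameters are the Satake parameters of `σ` (`IsSatakeFamilyOf.conj`). [folklore] -/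
theorem IsTorusUnramifiedAt.star (hW : IsTorusUnramifiedAt n K W v ϖ x) :
    IsTorusUnramifiedAt n K (star W) v ϖ (star x) where
  valued_eq := hW.valued_eq
  spherical k hk g := by simp only [Pi.star_apply, hW.spherical k hk g]
  shintani g hg mu := by
    change conj (W (GLn.ofLocal n K v (piPowGL ϖ.ne_zero mu) * g)) = _ * _ * conj (W g)
    rw [hW.shintani g hg mu, map_mul, map_mul, map_zpow₀, Complex.conj_ofReal, conj_schurTrunc]

/-- **The pair integrand on the translate `ϖ_v^μ · a` of a point `a` of the unit box.** If `W`, `W'` are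
unramified Whittaker–Hecke data at `v` with parameters `x`, `y` and `Φ` is spherical at `v`, then for `a`
with unit entries at `v` and `k ∈ K`, `I_s(ϖ^μ a, k) = s_μ(x) s_μ(y) q_v^{-s|μ|} · I_s(a, k)`: Shintani's
formula for each of `W`, `W'` contributes `q_v^{-b(μ)/2} s_μ`, the complex Jacobian `|det|^s δ_B⁻¹`
contributes `q_v^{b(μ) - s|μ|}`, and `Φ(e_n ·)` does not change (Jacquet–Shalika (1981), §2; Cogdell (2004),
proof of Thm. 3.3). [folklore] -/
theorem torusPairIntegrandC_localTorusPow_mul (hW : IsTorusUnramifiedAt n K W v ϖ x)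
    (hW' : IsTorusUnramifiedAt n K W' v ϖ y) (hΦ : IsLastRowSphericalAt n K Φ v) (s : ℂ) (mu : Fin n → ℕ)
    {a : Fin n → ideleGroup K} (ha : ∀ i, Valued.v (((a i : ideleGroup K) : AdeleRing (𝓞 K) K).2 v) = 1)
    (k : ↥(maximalCompactAdelic n K)) :
    torusPairIntegrandC n K W W' Φ s (localTorusPow ϖ mu * a, k) =
      localPairCoeffC v x y s mu * torusPairIntegrandC n K W W' Φ s (a, k) := by
  have hq : (0 : ℝ) < v.residueCard := by exact_mod_cast zero_lt_one.trans v.one_lt_residueCard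
  have hq0 : (v.residueCard : ℂ) ≠ 0 := by exact_mod_cast hq.ne'
  set g := torusPoint n K (a, k) with hg
  have hpt : torusPoint n K (localTorusPow ϖ mu * a, k) = GLn.ofLocal n K v (piPowGL ϖ.ne_zero mu) * g := by
    rw [torusPoint_mul, glDiagonal_localTorusPow]
  -- Shintani for `W` and for `W'`
  have hWμ : W (torusPoint n K (localTorusPow ϖ mu * a, k)) =
      (((Real.sqrt (v.residueCard : ℝ) : ℝ) : ℂ)) ^ (-torusExponent mu) * schurTrunc x mu * W g := by
    rw [hpt]
    exact hW.apply_ofLocal_piPowGL_mul (localComponent_torusPoint_mem_glInt ha k) mu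
  have hW'μ : W' (torusPoint n K (localTorusPow ϖ mu * a, k)) =
      (((Real.sqrt (v.residueCard : ℝ) : ℝ) : ℂ)) ^ (-torusExponent mu) * schurTrunc y mu * W' g := by
    rw [hpt]
    exact hW'.apply_ofLocal_piPowGL_mul (localComponent_torusPoint_mem_glInt ha k) mu
  -- `Φ(e_n ·)` is unchanged
  have hΦ' : Φ (lastRow n K (torusPoint n K (localTorusPow ϖ mu * a, k))) = Φ (lastRow n K g) := by
    rw [torusPoint_mul, lastRow_glDiagonal_mul]
    obtain ⟨h1, h2, m, h3⟩ := lastEntry_localTorusPow (n := n) ϖ mu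
    refine hΦ.smul_eq _ _ h1 h2 ?_ ?_ (valued_lastRow_torusPoint_le_one ha k)
    · rw [h3, Units.val_pow_eq_pow_val, map_pow, hW.valued_eq, ← WithZero.exp_nsmul, ← WithZero.exp_zero,
        WithZero.exp_le_exp]
      simp
    · rw [h3]
      exact Units.ne_zero _
  -- the complex Jacobian
  have hwt : torusWeightC n K s (localTorusPow ϖ mu * a) =
      (v.residueCard : ℂ) ^ ((torusExponent mu : ℂ) - s * ∑ i, (mu i : ℂ)) * torusWeightC n K s a := by
    rw [torusWeightC_mul, torusWeightC_localTorusPow hW.valued_eq]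
  -- combine the powers of `q_v`
  have hpow : (((Real.sqrt (v.residueCard : ℝ) : ℝ) : ℂ)) ^ (-torusExponent mu) *
      (((Real.sqrt (v.residueCard : ℝ) : ℝ) : ℂ)) ^ (-torusExponent mu) *
        (v.residueCard : ℂ) ^ ((torusExponent mu : ℂ) - s * ∑ i, (mu i : ℂ)) =
      (v.residueCard : ℂ) ^ (-(s * ∑ i, (mu i : ℂ))) := by
    rw [← mul_zpow, ← Complex.ofReal_mul, Real.mul_self_sqrt hq.le, Complex.ofReal_natCast,
      ← Complex.cpow_intCast, ← Complex.cpow_add _ _ hq0]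
    congr 1
    push_cast
    ring
  rw [torusPairIntegrandC, hWμ, hW'μ, hΦ', hwt]
  calc (((Real.sqrt (v.residueCard : ℝ) : ℝ) : ℂ)) ^ (-torusExponent mu) * schurTrunc x mu * W g *
        ((((Real.sqrt (v.residueCard : ℝ) : ℝ) : ℂ)) ^ (-torusExponent mu) * schurTrunc y mu * W' g) *
        (Φ (lastRow n K g) : ℂ) *
        ((v.residueCard : ℂ) ^ ((torusExponent mu : ℂ) - s * ∑ i, (mu i : ℂ)) * torusWeightC n K s a)
      = ((((Real.sqrt (v.residueCard : ℝ) : ℝ) : ℂ)) ^ (-torusExponent mu) *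
          (((Real.sqrt (v.residueCard : ℝ) : ℝ) : ℂ)) ^ (-torusExponent mu) *
            (v.residueCard : ℂ) ^ ((torusExponent mu : ℂ) - s * ∑ i, (mu i : ℂ))) *
          (schurTrunc x mu * schurTrunc y mu) * (W g * W' g * (Φ (lastRow n K g) : ℂ) * torusWeightC n K s a) := by
        ring
    _ = (v.residueCard : ℂ) ^ (-(s * ∑ i, (mu i : ℂ))) * (schurTrunc x mu * schurTrunc y mu) *
          (W g * W' g * (Φ (lastRow n K g) : ℂ) * torusWeightC n K s a) := by rw [hpow]
    _ = localPairCoeffC v x y s mu * torusPairIntegrandC n K W W' Φ s (a, k) := by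
        rw [localPairCoeffC, torusPairIntegrandC, ← hg]
        ring

end Translation

/-! ### The pair torus sum and the exact Euler factorisation -/

section EulerC

variable {n : ℕ} {K : Type} [Field K] [NumberField K]

/-- The **complex torus sum of a pair** `T_v(q_v^{-s}) = ∑_μ s_μ(x) s_μ(y) q_v^{-s|μ|}` (unconditional
`tsum`; it converges absolutely as soon as the two real torus sums at `re s` are finite,
`summable_localPairCoeffC`). [folklore] -/
def torusPairSumC (v : HeightOneSpectrum (𝓞 K)) (x y : Fin n → ℂ) (s : ℂ) : ℂ :=
  ∑' mu : Fin n → ℕ, localPairCoeffC v x y s mu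

/-- **Absolute convergence of the pair torus sum** from finiteness of the two real ones at `re s`. [folklore] -/
theorem summable_localPairCoeffC {v : HeightOneSpectrum (𝓞 K)} {x y : Fin n → ℂ} {s : ℂ}
    (hx : schurSelfSum x ((v.residueCard : ℝ) ^ (-s.re)) ≠ ⊤)
    (hy : schurSelfSum y ((v.residueCard : ℝ) ^ (-s.re)) ≠ ⊤) :
    Summable fun mu : Fin n → ℕ => localPairCoeffC v x y s mu :=
  Summable.of_norm_bounded (((summable_localCoeffC hx).norm.add (summable_localCoeffC hy).norm).div_const 2)
    fun mu => norm_localPairCoeffC_le v x y s mu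

variable [MeasurableSpace (ideleGroup K)] [BorelSpace (ideleGroup K)]

-- the house local instances of `RankinSelbergTorusIntegral` / `RankinSelbergTorusIntegralComplex` (Borel
-- structure of `GL_n(𝔸_K)`, second countability of `𝔸_Kˣ`); none overrides a Mathlib instance
attribute [local instance] adelicBorel borelSpace_adelic locallyCompactSpace_adelic
  secondCountableTopology_gl_adelic secondCountableTopology_ideleGroup

variable (νA : Measure (Fin n → ideleGroup K)) [νA.IsMulLeftInvariant] [SFinite νA]
  (νK : Measure ↥(maximalCompactAdelic n K)) [SFinite νK]

variable {v : HeightOneSpectrum (𝓞 K)} {ϖ : (v.adicCompletion K)ˣ} {x y : Fin n → ℂ}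
  {W W' : GL (Fin n) (AdeleRing (𝓞 K) K) → ℂ} {Φ : (Fin n → AdeleRing (𝓞 K) K) → ℝ}

/-- **The pair integral over a translate of the unit box.** Translating the torus variable by `ϖ_v^μ`
multiplies the Bochner integral of the pair integrand over `B × K`, `B` the unit box at `v` and `G`, by
`s_μ(x) s_μ(y) q_v^{-s|μ|}` (left invariance of the Haar measure of the torus and
`torusPairIntegrandC_localTorusPow_mul`; no integrability needed). [folklore] -/
theorem setIntegral_smul_unitBox_pair_eqC (hW : IsTorusUnramifiedAt n K W v ϖ x)
    (hW' : IsTorusUnramifiedAt n K W' v ϖ y) (hΦ : IsLastRowSphericalAt n K Φ v) (s : ℂ)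
    (G : Set (HeightOneSpectrum (𝓞 K))) (mu : Fin n → ℕ) :
    ∫ p in (localTorusPow ϖ mu • unitBox (insert v G)) ×ˢ Set.univ, torusPairIntegrandC n K W W' Φ s p
        ∂(νA.prod νK) =
      localPairCoeffC v x y s mu *
        ∫ p in unitBox (insert v G) ×ˢ Set.univ, torusPairIntegrandC n K W W' Φ s p ∂(νA.prod νK) := by
  set t := localTorusPow (n := n) ϖ mu with ht
  set B := unitBox (n := n) (K := K) (insert v G) with hB
  let e : (Fin n → ideleGroup K) × ↥(maximalCompactAdelic n K) ≃ᵐ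
      (Fin n → ideleGroup K) × ↥(maximalCompactAdelic n K) :=
    (MeasurableEquiv.mulLeft t).prodCongr (MeasurableEquiv.refl _)
  have he : ⇑e = Prod.map (t * ·) id := rfl
  have hmp : MeasurePreserving e (νA.prod νK) (νA.prod νK) := by
    rw [he]
    exact (measurePreserving_mul_left νA t).prod (MeasurePreserving.id νK)
  have hpre : e ⁻¹' ((t • B) ×ˢ Set.univ) = B ×ˢ Set.univ := by
    ext p
    simp only [he, Set.mem_preimage, Set.mem_prod, Set.mem_univ, and_true, Prod.map_fst]
    exact Set.smul_mem_smul_set_iff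
  calc ∫ p in (t • B) ×ˢ Set.univ, torusPairIntegrandC n K W W' Φ s p ∂(νA.prod νK)
      = ∫ p in e ⁻¹' ((t • B) ×ˢ Set.univ), torusPairIntegrandC n K W W' Φ s (e p) ∂(νA.prod νK) :=
        (hmp.setIntegral_preimage_emb e.measurableEmbedding _ _).symm
    _ = ∫ p in B ×ˢ Set.univ, torusPairIntegrandC n K W W' Φ s (t * p.1, p.2) ∂(νA.prod νK) := by
        rw [hpre]
        rfl
    _ = ∫ p in B ×ˢ Set.univ, localPairCoeffC v x y s mu * torusPairIntegrandC n K W W' Φ s p ∂(νA.prod νK) := by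
        refine setIntegral_congr_fun ((measurableSet_unitBox _).prod MeasurableSet.univ) fun p hp => ?_
        exact torusPairIntegrandC_localTorusPow_mul hW hW' hΦ s mu (fun i => hp.1 v (Set.mem_insert v G) i) p.2
    _ = localPairCoeffC v x y s mu * ∫ p in B ×ˢ Set.univ, torusPairIntegrandC n K W W' Φ s p ∂(νA.prod νK) :=
        integral_const_mul _ _

omit [MeasurableSpace (ideleGroup K)] [BorelSpace (ideleGroup K)] in
/-- **The pair integrand vanishes where the real integrand of `W` does**: on the unit box off `G ∌ v`,
off the translates `ϖ_v^μ B(insert v G)` (`torusIntegrand_eq_zero_of_not_mem_iUnion` for `W`: there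
`|W|² Φ w = 0`, so `W = 0` or `Φ = 0` at the point). [folklore] -/
theorem torusPairIntegrandC_eq_zero_of_not_mem_iUnion (hn : 0 < n) (hW : IsTorusUnramifiedAt n K W v ϖ x)
    (hWZ : ∀ (z : ideleGroup K) (g : GL (Fin n) (AdeleRing (𝓞 K) K)),
      ‖W (Matrix.GeneralLinearGroup.scalar (Fin n) z * g)‖ = ‖W g‖)
    (hΦv : ∀ y : Fin n → AdeleRing (𝓞 K) K, Φ y ≠ 0 → ∀ j, Valued.v ((y j).2 v) ≤ 1)
    (hΦ0 : ∀ y, 0 ≤ Φ y) (s : ℂ) {G : Set (HeightOneSpectrum (𝓞 K))} (hv : v ∉ G)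
    {a : Fin n → ideleGroup K} (ha : a ∈ unitBox (n := n) (K := K) G) (k : ↥(maximalCompactAdelic n K))
    (hnot : a ∉ ⋃ mu : Fin n → ℕ, localTorusPow ϖ mu • unitBox (n := n) (K := K) (insert v G)) :
    torusPairIntegrandC n K W W' Φ s (a, k) = 0 := by
  have h := torusIntegrand_eq_zero_of_not_mem_iUnion hn hW hWZ hΦv s.re hv ha k hnot
  rw [torusIntegrand, ENNReal.ofReal_eq_zero] at h
  have hw : 0 < torusWeight n K s.re a := torusWeight_pos s.re a
  have h0 : ‖W (torusPoint n K (a, k))‖ ^ 2 * Φ (lastRow n K (torusPoint n K (a, k))) = 0 := by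
    have h1 : 0 ≤ ‖W (torusPoint n K (a, k))‖ ^ 2 * Φ (lastRow n K (torusPoint n K (a, k))) :=
      mul_nonneg (sq_nonneg _) (hΦ0 _)
    nlinarith [mul_nonneg h1 hw.le]
  rcases mul_eq_zero.1 h0 with h2 | h2
  · have hW0 : W (torusPoint n K (a, k)) = 0 := norm_eq_zero.1 (pow_eq_zero_iff two_ne_zero |>.1 h2)
    rw [torusPairIntegrandC, hW0]
    simp
  · rw [torusPairIntegrandC, h2]
    simp

/-- **One exact Euler factor of the pair at a complex point.** For `v ∉ G`, `W`, `W'` unramified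
Whittaker–Hecke data at `v` (with `‖W‖` central-invariant), `Φ ≥ 0` spherical at `v` and supported on
`v`-integral rows, and the pair integrand integrable on `B(G) × K`:
`∑_μ s_μ(x) s_μ(y) q_v^{-s|μ|} · ∫_{B(insert v G) × K} I_s` converges to `∫_{B(G) × K} I_s`. [folklore] -/
theorem hasSum_localPairCoeffC_mul_setIntegral (hn : 0 < n) (hW : IsTorusUnramifiedAt n K W v ϖ x)
    (hW' : IsTorusUnramifiedAt n K W' v ϖ y)
    (hWZ : ∀ (z : ideleGroup K) (g : GL (Fin n) (AdeleRing (𝓞 K) K)),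
      ‖W (Matrix.GeneralLinearGroup.scalar (Fin n) z * g)‖ = ‖W g‖)
    (hΦ : IsLastRowSphericalAt n K Φ v)
    (hΦv : ∀ y : Fin n → AdeleRing (𝓞 K) K, Φ y ≠ 0 → ∀ j, Valued.v ((y j).2 v) ≤ 1)
    (hΦ0 : ∀ y, 0 ≤ Φ y) (s : ℂ) {G : Set (HeightOneSpectrum (𝓞 K))} (hv : v ∉ G)
    (hint : IntegrableOn (torusPairIntegrandC n K W W' Φ s) (unitBox G ×ˢ Set.univ) (νA.prod νK)) :
    HasSum (fun mu : Fin n → ℕ => localPairCoeffC v x y s mu *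
        ∫ p in unitBox (insert v G) ×ˢ Set.univ, torusPairIntegrandC n K W W' Φ s p ∂(νA.prod νK))
      (∫ p in unitBox G ×ˢ Set.univ, torusPairIntegrandC n K W W' Φ s p ∂(νA.prod νK)) := by
  have hUm : ∀ mu : Fin n → ℕ, MeasurableSet ((localTorusPow ϖ mu • unitBox (n := n) (K := K) (insert v G)) ×ˢ
      (Set.univ : Set ↥(maximalCompactAdelic n K))) := fun mu =>
    (measurableSet_smul_unitBox _ _).prod MeasurableSet.univ
  have hdisj : Pairwise (Function.onFun Disjoint fun mu : Fin n → ℕ =>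
      (localTorusPow ϖ mu • unitBox (n := n) (K := K) (insert v G)) ×ˢ
        (Set.univ : Set ↥(maximalCompactAdelic n K))) := fun mu mu' hne =>
    Set.disjoint_prod.2 (Or.inl (pairwise_disjoint_localTorusPow_smul_unitBox hW.valued_eq G hne))
  have hSM : MeasurableSet (unitBox (n := n) (K := K) G ×ˢ (Set.univ : Set ↥(maximalCompactAdelic n K))) :=
    (measurableSet_unitBox _).prod MeasurableSet.univ
  have hsub : (⋃ mu : Fin n → ℕ, (localTorusPow ϖ mu • unitBox (n := n) (K := K) (insert v G)) ×ˢ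
      (Set.univ : Set ↥(maximalCompactAdelic n K))) ⊆ unitBox G ×ˢ Set.univ :=
    Set.iUnion_subset fun mu => Set.prod_mono (localTorusPow_smul_unitBox_subset hv mu) subset_rfl
  have heq : ∫ p in unitBox G ×ˢ Set.univ, torusPairIntegrandC n K W W' Φ s p ∂(νA.prod νK) =
      ∫ p in ⋃ mu : Fin n → ℕ, (localTorusPow ϖ mu • unitBox (n := n) (K := K) (insert v G)) ×ˢ
        (Set.univ : Set ↥(maximalCompactAdelic n K)), torusPairIntegrandC n K W W' Φ s p ∂(νA.prod νK) := by
    refine setIntegral_eq_of_subset_of_forall_sdiff_eq_zero hSM hsub ?_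
    rintro ⟨a, k⟩ ⟨⟨haB, -⟩, hpU⟩
    refine torusPairIntegrandC_eq_zero_of_not_mem_iUnion hn hW hWZ hΦv hΦ0 s hv haB k fun hmem => hpU ?_
    obtain ⟨mu, hmu⟩ := Set.mem_iUnion.1 hmem
    exact Set.mem_iUnion.2 ⟨mu, Set.mk_mem_prod hmu (Set.mem_univ _)⟩
  rw [heq]
  simp_rw [← setIntegral_smul_unitBox_pair_eqC νA νK hW hW' hΦ s G]
  exact hasSum_integral_iUnion hUm hdisj (hint.mono_set hsub)

/-- **One exact Euler factor of the pair, closed form**: `T_v(q_v^{-s}) · ∫_{B(insert v G) × K} I_s =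
∫_{B(G) × K} I_s` with `T_v = torusPairSumC v x y s`. [folklore] -/
theorem torusPairSumC_mul_setIntegral_eq (hn : 0 < n) (hW : IsTorusUnramifiedAt n K W v ϖ x)
    (hW' : IsTorusUnramifiedAt n K W' v ϖ y)
    (hWZ : ∀ (z : ideleGroup K) (g : GL (Fin n) (AdeleRing (𝓞 K) K)),
      ‖W (Matrix.GeneralLinearGroup.scalar (Fin n) z * g)‖ = ‖W g‖)
    (hΦ : IsLastRowSphericalAt n K Φ v)
    (hΦv : ∀ y : Fin n → AdeleRing (𝓞 K) K, Φ y ≠ 0 → ∀ j, Valued.v ((y j).2 v) ≤ 1)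
    (hΦ0 : ∀ y, 0 ≤ Φ y) (s : ℂ) {G : Set (HeightOneSpectrum (𝓞 K))} (hv : v ∉ G)
    (hint : IntegrableOn (torusPairIntegrandC n K W W' Φ s) (unitBox G ×ˢ Set.univ) (νA.prod νK)) :
    torusPairSumC v x y s * ∫ p in unitBox (insert v G) ×ˢ Set.univ, torusPairIntegrandC n K W W' Φ s p
        ∂(νA.prod νK) =
      ∫ p in unitBox G ×ˢ Set.univ, torusPairIntegrandC n K W W' Φ s p ∂(νA.prod νK) := by
  rw [← (hasSum_localPairCoeffC_mul_setIntegral νA νK hn hW hW' hWZ hΦ hΦv hΦ0 s hv hint).tsum_eq,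
    tsum_mul_right, torusPairSumC]

variable {ϖ : ∀ v : HeightOneSpectrum (𝓞 K), (v.adicCompletion K)ˣ}
  {x y : HeightOneSpectrum (𝓞 K) → Fin n → ℂ}

/-- **The exact Euler factorisation of the pair on the unit boxes at a complex point.** For every finite
`F ⊆ Good`: `(∏_{v ∈ F} T_v(q_v^{-s})) · ∫_{B(Good) × K} I_s = ∫_{B(Good ∖ F) × K} I_s` (induction on `F`).
[cite: JacquetShalikaAJM1981, §2 Prop. (2.3), §4] -/
theorem prod_torusPairSumC_mul_setIntegral_eq (hn : 0 < n) {Good : Set (HeightOneSpectrum (𝓞 K))}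
    (hW : ∀ v ∈ Good, IsTorusUnramifiedAt n K W v (ϖ v) (x v))
    (hW' : ∀ v ∈ Good, IsTorusUnramifiedAt n K W' v (ϖ v) (y v))
    (hWZ : ∀ (z : ideleGroup K) (g : GL (Fin n) (AdeleRing (𝓞 K) K)),
      ‖W (Matrix.GeneralLinearGroup.scalar (Fin n) z * g)‖ = ‖W g‖)
    (hΦ : ∀ v ∈ Good, IsLastRowSphericalAt n K Φ v)
    (hΦv : ∀ v ∈ Good, ∀ y : Fin n → AdeleRing (𝓞 K) K, Φ y ≠ 0 → ∀ j, Valued.v ((y j).2 v) ≤ 1)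
    (hΦ0 : ∀ y, 0 ≤ Φ y) (s : ℂ) (hint : Integrable (torusPairIntegrandC n K W W' Φ s) (νA.prod νK))
    (F : Finset (HeightOneSpectrum (𝓞 K))) (hF : (↑F : Set (HeightOneSpectrum (𝓞 K))) ⊆ Good) :
    (∏ v ∈ F, torusPairSumC v (x v) (y v) s) *
        ∫ p in unitBox Good ×ˢ Set.univ, torusPairIntegrandC n K W W' Φ s p ∂(νA.prod νK) =
      ∫ p in unitBox (Good \ ↑F) ×ˢ Set.univ, torusPairIntegrandC n K W W' Φ s p ∂(νA.prod νK) := by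
  classical
  induction F using Finset.induction_on with
  | empty => simp
  | insert v F hvF ih =>
    have hv : v ∈ Good := hF (Finset.mem_coe.2 (Finset.mem_insert_self v F))
    have hF' : (↑F : Set (HeightOneSpectrum (𝓞 K))) ⊆ Good := fun w hw =>
      hF (Finset.mem_coe.2 (Finset.mem_insert_of_mem (Finset.mem_coe.1 hw)))
    rw [Finset.prod_insert hvF, mul_assoc, ih hF']
    have hset : Good \ ↑F = insert v (Good \ ↑(insert v F)) := by
      ext w
      by_cases hw : w = v
      · subst hw
        simp [hv, hvF]
      · simp [hw]
    rw [hset]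
    exact torusPairSumC_mul_setIntegral_eq νA νK hn (hW v hv) (hW' v hv) hWZ (hΦ v hv) (hΦv v hv) hΦ0 s (by simp)
      hint.integrableOn

/-- **The exact Euler factorisation of the unfolded Rankin–Selberg integral of a pair at a complex point
over a finite set of unramified places**: `(∏_{v ∈ F} T_v(q_v^{-s})) · ∫_{B(F) × K} I_s = Ψ(s; W, W', Φ)`,
the full Bochner pair integral `rankinSelbergTorusPairIntegralC νA νK W W' Φ s` (Jacquet–Shalika (1981),
§2 Prop. (2.3) and §4; Cogdell (2004), Thm. 2.2 with Thm. 3.3: "this is Eulerian … `Ψ_v = det(I - q_v^{-s}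
A_{π_v} ⊗ A_{π'_v})⁻¹`").
[cite: JacquetShalikaAJM1981, §2 Prop. (2.3), §4] [cite: CogdellAnalyticTheory2004, Thm. 2.2, Thm. 3.3] -/
theorem prod_torusPairSumC_mul_setIntegral_eq_rankinSelbergTorusPairIntegralC (hn : 0 < n)
    (F : Finset (HeightOneSpectrum (𝓞 K)))
    (hW : ∀ v ∈ F, IsTorusUnramifiedAt n K W v (ϖ v) (x v))
    (hW' : ∀ v ∈ F, IsTorusUnramifiedAt n K W' v (ϖ v) (y v))
    (hWZ : ∀ (z : ideleGroup K) (g : GL (Fin n) (AdeleRing (𝓞 K) K)),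
      ‖W (Matrix.GeneralLinearGroup.scalar (Fin n) z * g)‖ = ‖W g‖)
    (hΦ : ∀ v ∈ F, IsLastRowSphericalAt n K Φ v)
    (hΦv : ∀ v ∈ F, ∀ y : Fin n → AdeleRing (𝓞 K) K, Φ y ≠ 0 → ∀ j, Valued.v ((y j).2 v) ≤ 1)
    (hΦ0 : ∀ y, 0 ≤ Φ y) (s : ℂ) (hint : Integrable (torusPairIntegrandC n K W W' Φ s) (νA.prod νK)) :
    (∏ v ∈ F, torusPairSumC v (x v) (y v) s) *
        ∫ p in unitBox (↑F : Set (HeightOneSpectrum (𝓞 K))) ×ˢ Set.univ, torusPairIntegrandC n K W W' Φ s p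
          ∂(νA.prod νK) =
      rankinSelbergTorusPairIntegralC n K νA νK W W' Φ s := by
  rw [prod_torusPairSumC_mul_setIntegral_eq νA νK hn (Good := ↑F) (fun v hv => hW v (Finset.mem_coe.1 hv))
    (fun v hv => hW' v (Finset.mem_coe.1 hv)) hWZ (fun v hv => hΦ v (Finset.mem_coe.1 hv))
    (fun v hv => hΦv v (Finset.mem_coe.1 hv)) hΦ0 s hint F subset_rfl,
    Set.sdiff_self, unitBox_empty, Set.univ_prod_univ, Measure.restrict_univ]
  rfl

end EulerC

/-! ### The pair torus sum in closed form (Cauchy's identity for two alphabets) -/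

section CauchyC

variable {n : ℕ} {K : Type} [Field K] [NumberField K] {v : HeightOneSpectrum (𝓞 K)} {x y : Fin n → ℂ}

/-- **Cauchy's identity for `∑_μ s_μ(x) s_μ(y) t^{|μ|}` at a complex `t`.** If `‖x_i y_j t‖ < 1` for all
`i, j` and the family `μ ↦ s_μ(x) s_μ(y) t^{|μ|}` is summable, then
`∑_μ s_μ(x) s_μ(y) t^{|μ|} = ∏_{i,j} (1 - x_i y_j t)⁻¹` (`hasSum_shintaniPair` for the pair of Schur solutions
of the dual Pieri recursions, regrouped fibrewise over `|μ| = N`; Macdonald (1995), Ch. I (4.3)).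
[cite: Macdonald1995, Ch. I (4.3)] -/
theorem hasSum_schurTrunc_mul_schurTrunc_mul_pow {t : ℂ} (ht : ∀ i j, ‖x i * y j * t‖ < 1)
    (hsum : Summable fun mu : Fin n → ℕ => schurTrunc x mu * schurTrunc y mu * t ^ (∑ i, mu i)) :
    HasSum (fun mu : Fin n → ℕ => schurTrunc x mu * schurTrunc y mu * t ^ (∑ i, mu i))
      (∏ i, ∏ j, (1 - x i * y j * t)⁻¹) := by
  classical
  obtain ⟨S, hS⟩ := hsum
  have hC := hasSum_shintaniPair x y (schurTrunc x) (schurTrunc y)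
    (fun ν hν => schurTrunc_of_not_antitone x hν) (schurTrunc_pieri x)
    (fun ν hν => schurTrunc_of_not_antitone y hν) (schurTrunc_pieri y) ht
  rw [schurTrunc_zero, schurTrunc_zero, one_mul, one_mul] at hC
  have hfib := hS.tsum_fiberwise fun mu : Fin n → ℕ => ∑ i, mu i
  have hterm : ∀ N : ℕ, ∑' mu : ((fun mu : Fin n → ℕ => ∑ i, mu i) ⁻¹' {N}),
      schurTrunc x (mu : Fin n → ℕ) * schurTrunc y (mu : Fin n → ℕ) * t ^ (∑ i, (mu : Fin n → ℕ) i) =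
        (∑ m ∈ piAntidiag univ N, schurTrunc x m * schurTrunc y m) * t ^ N := by
    intro N
    have hset : ((fun mu : Fin n → ℕ => ∑ i, mu i) ⁻¹' {N}) = ↑(piAntidiag (univ : Finset (Fin n)) N) := by
      ext mu
      simp [mem_piAntidiag]
    rw [tsum_congr_set_coe (fun mu : Fin n → ℕ => schurTrunc x mu * schurTrunc y mu * t ^ (∑ i, mu i)) hset,
      Finset.tsum_subtype' (piAntidiag (univ : Finset (Fin n)) N)
        (fun mu : Fin n → ℕ => schurTrunc x mu * schurTrunc y mu * t ^ (∑ i, mu i)), Finset.sum_mul]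
    refine Finset.sum_congr rfl fun m hm => ?_
    rw [(mem_piAntidiag.1 hm).1]
  simp_rw [hterm] at hfib
  have hSC : S = ∏ i, ∏ j, (1 - x i * y j * t)⁻¹ := hfib.unique hC
  rwa [hSC] at hS

/-- `‖x_i‖ ‖y_j‖ r < 1` from the finiteness of the two Schur self-sums at `r ≥ 0`
(`(‖x_i‖ ‖y_j‖ r)² = (‖x_i‖² r)(‖y_j‖² r) < 1`). [folklore] -/
theorem norm_mul_norm_mul_lt_one_of_schurSelfSum_ne_top_pair {r : ℝ} (hr : 0 ≤ r)
    (hx : schurSelfSum x r ≠ ⊤) (hy : schurSelfSum y r ≠ ⊤) (i j : Fin n) : ‖x i‖ * ‖y j‖ * r < 1 := by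
  have h1 := norm_mul_norm_mul_lt_one_of_schurSelfSum_ne_top x hr hx i i
  have h2 := norm_mul_norm_mul_lt_one_of_schurSelfSum_ne_top y hr hy j j
  have ha : 0 ≤ ‖x i‖ * ‖x i‖ * r := by positivity
  have hb : 0 ≤ ‖y j‖ * ‖y j‖ * r := by positivity
  have hc : 0 ≤ ‖x i‖ * ‖y j‖ * r := by positivity
  nlinarith [mul_lt_one_of_nonneg_of_lt_one_left ha h1 h2.le, sq_nonneg (‖x i‖ * ‖y j‖ * r)]

/-- **The pair torus sum in closed form.** If the two real torus sums at `re s` are finite, then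
`T_v(q_v^{-s}) = ∑_μ s_μ(x) s_μ(y) q_v^{-s|μ|} = ∏_{i,j} (1 - x_i y_j q_v^{-s})⁻¹ = det(1 - q_v^{-s} A ⊗ B)⁻¹`,
`A = diag(x)`, `B = diag(y)` — the unramified local Rankin–Selberg factor `L(s, π_v × π'_v)` for Satake
parameters `x`, `y` (Jacquet–Shalika (1981), §2 Prop. (2.3); Cogdell (2004), Thm. 3.3).
[cite: JacquetShalikaAJM1981, §2 Prop. (2.3)] -/
theorem torusPairSumC_eq_prod_inv {s : ℂ} (hx : schurSelfSum x ((v.residueCard : ℝ) ^ (-s.re)) ≠ ⊤)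
    (hy : schurSelfSum y ((v.residueCard : ℝ) ^ (-s.re)) ≠ ⊤) :
    torusPairSumC v x y s = ∏ i, ∏ j, (1 - x i * y j * (v.residueCard : ℂ) ^ (-s))⁻¹ := by
  have hq : (0 : ℝ) < v.residueCard := by exact_mod_cast zero_lt_one.trans v.one_lt_residueCard
  have hterm : ∀ mu : Fin n → ℕ, localPairCoeffC v x y s mu =
      schurTrunc x mu * schurTrunc y mu * ((v.residueCard : ℂ) ^ (-s)) ^ (∑ i, mu i) := by
    intro mu
    rw [localPairCoeffC, ← Complex.cpow_nat_mul, Nat.cast_sum]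
    congr 2
    ring
  have hnorm : ‖(v.residueCard : ℂ) ^ (-s)‖ = (v.residueCard : ℝ) ^ (-s.re) := by
    rw [← Complex.ofReal_natCast, Complex.norm_cpow_eq_rpow_re_of_pos hq, Complex.neg_re]
  have ht : ∀ i j, ‖x i * y j * (v.residueCard : ℂ) ^ (-s)‖ < 1 := fun i j => by
    rw [norm_mul, norm_mul, hnorm]
    exact norm_mul_norm_mul_lt_one_of_schurSelfSum_ne_top_pair (Real.rpow_nonneg hq.le _) hx hy i j
  have hsum : Summable fun mu : Fin n → ℕ =>
      schurTrunc x mu * schurTrunc y mu * ((v.residueCard : ℂ) ^ (-s)) ^ (∑ i, mu i) :=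
    (summable_localPairCoeffC hx hy).congr hterm
  rw [torusPairSumC, tsum_congr hterm, (hasSum_schurTrunc_mul_schurTrunc_mul_pow ht hsum).tsum_eq]

/-- **… and as the inverse of the Satake pair polynomial**: if `x`, `y` enumerate the multisets `α`, `β`,
then `T_v(q_v^{-s}) = (P_{α,β}(q_v^{-s}))⁻¹` with `P_{α,β}(X) = ∏_{a ∈ α, b ∈ β} (1 - a b X)`
(`satakePairPolynomial`), the local factor of `partialPairL S α β` at an unramified place.
[cite: JacquetShalikaAJM1981, §2 Prop. (2.3)] -/
theorem torusPairSumC_eq_inv_eval_satakePairPolynomial {s : ℂ}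
    (hx : schurSelfSum x ((v.residueCard : ℝ) ^ (-s.re)) ≠ ⊤)
    (hy : schurSelfSum y ((v.residueCard : ℝ) ^ (-s.re)) ≠ ⊤) {α β : Multiset ℂ}
    (hxα : (univ : Finset (Fin n)).val.map x = α) (hyβ : (univ : Finset (Fin n)).val.map y = β) :
    torusPairSumC v x y s = ((satakePairPolynomial α β).eval ((v.residueCard : ℂ) ^ (-s)))⁻¹ := by
  have hR : (satakePairPolynomial α β).eval ((v.residueCard : ℂ) ^ (-s)) =
      ∏ i, ∏ j, (1 - x i * y j * (v.residueCard : ℂ) ^ (-s)) := by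
    subst hxα hyβ
    rw [satakePairPolynomial, Polynomial.eval_multiset_prod, Multiset.map_map,
      Multiset.prod_map_product_eq_prod_prod, Multiset.map_map, Finset.prod_eq_multiset_prod]
    congr 1
    refine Multiset.map_congr rfl fun i _ => ?_
    simp only [Function.comp_apply, Multiset.map_map]
    rw [Finset.prod_eq_multiset_prod]
    congr 1
    refine Multiset.map_congr rfl fun j _ => ?_
    simp only [Polynomial.eval_sub, Polynomial.eval_one, Polynomial.eval_mul, Polynomial.eval_C,
      Polynomial.eval_X]
  rw [torusPairSumC_eq_prod_inv hx hy, hR]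
  simp only [Finset.prod_inv_distrib]

end CauchyC

/-! ### All good places: `Ψ(s; W, W', Φ) = L^{S'}(s, π × π') · Ψ_{S'}(s)` -/

section Limit

variable {n : ℕ} {K : Type} [Field K] [NumberField K]
variable [MeasurableSpace (ideleGroup K)] [BorelSpace (ideleGroup K)]

attribute [local instance] adelicBorel borelSpace_adelic locallyCompactSpace_adelic
  secondCountableTopology_gl_adelic secondCountableTopology_ideleGroup

variable (νA : Measure (Fin n → ideleGroup K)) [νA.IsMulLeftInvariant] [SFinite νA]
  (νK : Measure ↥(maximalCompactAdelic n K)) [SFinite νK]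
  {W W' : GL (Fin n) (AdeleRing (𝓞 K) K) → ℂ} {Φ : (Fin n → AdeleRing (𝓞 K) K) → ℝ}

omit [νA.IsMulLeftInvariant] [SFinite νA] [SFinite νK] in
/-- **The box integrals of the pair converge to the integral over the good-unit torus**: along the finite
sets `F` of good places, `∫_{B(F) × K} I_s → ∫_{B({v ∉ S'}) × K} I_s` (decreasing sets, integrable integrand;
as `tendsto_setIntegral_unitBox_image`). [folklore] -/
theorem tendsto_setIntegral_unitBox_image_pair (S' : Set (HeightOneSpectrum (𝓞 K))) {s : ℂ}
    (hint : Integrable (torusPairIntegrandC n K W W' Φ s) (νA.prod νK)) :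
    Tendsto (fun F : Finset {v : HeightOneSpectrum (𝓞 K) // v ∉ S'} =>
        ∫ p in unitBox (↑(F.map (Function.Embedding.subtype fun v => v ∉ S')) : Set (HeightOneSpectrum (𝓞 K))) ×ˢ Set.univ,
          torusPairIntegrandC n K W W' Φ s p ∂(νA.prod νK))
      atTop (𝓝 (∫ p in unitBox {v | v ∉ S'} ×ˢ Set.univ, torusPairIntegrandC n K W W' Φ s p ∂(νA.prod νK))) := by
  haveI : Countable (HeightOneSpectrum (𝓞 K)) := countable_heightOneSpectrum K
  have h := tendsto_setIntegral_of_antitone (μ := νA.prod νK) (f := torusPairIntegrandC n K W W' Φ s)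
    (s := fun F : Finset {v : HeightOneSpectrum (𝓞 K) // v ∉ S'} =>
      unitBox (n := n) (K := K) (↑(F.map (Function.Embedding.subtype fun v => v ∉ S')) : Set (HeightOneSpectrum (𝓞 K))) ×ˢ
        (Set.univ : Set ↥(maximalCompactAdelic n K)))
    (fun F => (measurableSet_unitBox _).prod MeasurableSet.univ)
    (fun F F' h => Set.prod_mono (unitBox_image_antitone S' h) subset_rfl) ⟨∅, hint.integrableOn⟩
  have hset : (⋂ F : Finset {v : HeightOneSpectrum (𝓞 K) // v ∉ S'},
      unitBox (n := n) (K := K) (↑(F.map (Function.Embedding.subtype fun v => v ∉ S')) : Set (HeightOneSpectrum (𝓞 K))) ×ˢ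
        (Set.univ : Set ↥(maximalCompactAdelic n K))) = unitBox {v | v ∉ S'} ×ˢ Set.univ := by
    rw [← iInter_unitBox_image_eq]
    ext p
    simp only [Set.mem_iInter, Set.mem_prod, Set.mem_univ, and_true]
  rwa [hset] at h

variable {ϖ : ∀ v : HeightOneSpectrum (𝓞 K), (v.adicCompletion K)ˣ} {x y : HeightOneSpectrum (𝓞 K) → Fin n → ℂ}

/-- **The Euler factorisation of the unfolded Rankin–Selberg integral of a PAIR at a complex point into
the partial `L`-function and the `S'`-part.** Let `W`, `W'` be unramified Whittaker–Hecke data at every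
`v ∉ S'` with parameters `x_v`, `y_v` enumerating `α_v`, `β_v` (and `‖W‖` central-invariant), `Φ ≥ 0`
spherical and integrally supported off `S'`, `I_s` integrable and the real torus sums of `x_v`, `y_v` at
`re s` finite off `S'`. If the unramified local factors `P_{α_v, β_v}(q_v^{-s})⁻¹`, `v ∉ S'`, have the
product `L`, then `Ψ(s; W, W', Φ) = L · ∫_{B({v ∉ S'}) × K} I_s`. With `L = partialPairL S' α β s`
(`hasProd_partialPairL`, `re s > 1`) this is `Ψ(s; W, W', Φ) = L^{S'}(s, π × π') · Ψ_{S'}(s)`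
(Jacquet–Shalika (1981), §4; Cogdell (2004), Thm. 2.2 with Thm. 3.3).
[cite: JacquetShalikaAJM1981, §2 Prop. (2.3), §4] [cite: CogdellAnalyticTheory2004, Thm. 2.2, Thm. 3.3] -/
theorem rankinSelbergTorusPairIntegralC_eq_mul_setIntegral_of_hasProd (hn : 0 < n)
    {S' : Set (HeightOneSpectrum (𝓞 K))} (hW : ∀ v ∉ S', IsTorusUnramifiedAt n K W v (ϖ v) (x v))
    (hW' : ∀ v ∉ S', IsTorusUnramifiedAt n K W' v (ϖ v) (y v))
    (hWZ : ∀ (z : ideleGroup K) (g : GL (Fin n) (AdeleRing (𝓞 K) K)),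
      ‖W (Matrix.GeneralLinearGroup.scalar (Fin n) z * g)‖ = ‖W g‖)
    (hΦ : ∀ v ∉ S', IsLastRowSphericalAt n K Φ v)
    (hΦv : ∀ v ∉ S', ∀ y : Fin n → AdeleRing (𝓞 K) K, Φ y ≠ 0 → ∀ j, Valued.v ((y j).2 v) ≤ 1)
    (hΦ0 : ∀ y, 0 ≤ Φ y) {s : ℂ} (hint : Integrable (torusPairIntegrandC n K W W' Φ s) (νA.prod νK))
    (hTx : ∀ v ∉ S', schurSelfSum (x v) ((v.residueCard : ℝ) ^ (-s.re)) ≠ ⊤)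
    (hTy : ∀ v ∉ S', schurSelfSum (y v) ((v.residueCard : ℝ) ^ (-s.re)) ≠ ⊤)
    {α β : HeightOneSpectrum (𝓞 K) → Multiset ℂ}
    (hx : ∀ v ∉ S', (univ : Finset (Fin n)).val.map (x v) = α v)
    (hy : ∀ v ∉ S', (univ : Finset (Fin n)).val.map (y v) = β v)
    {L : ℂ} (hL : HasProd (fun u : {v : HeightOneSpectrum (𝓞 K) // v ∉ S'} =>
      ((satakePairPolynomial (α u.1) (β u.1)).eval ((u.1.residueCard : ℂ) ^ (-s)))⁻¹) L) :
    rankinSelbergTorusPairIntegralC n K νA νK W W' Φ s =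
      L * ∫ p in unitBox {v | v ∉ S'} ×ˢ Set.univ, torusPairIntegrandC n K W W' Φ s p ∂(νA.prod νK) := by
  have hF : ∀ F : Finset {v : HeightOneSpectrum (𝓞 K) // v ∉ S'},
      (∏ u ∈ F, ((satakePairPolynomial (α u.1) (β u.1)).eval ((u.1.residueCard : ℂ) ^ (-s)))⁻¹) *
        ∫ p in unitBox (↑(F.map (Function.Embedding.subtype fun v => v ∉ S')) : Set (HeightOneSpectrum (𝓞 K))) ×ˢ Set.univ,
          torusPairIntegrandC n K W W' Φ s p ∂(νA.prod νK) =
      rankinSelbergTorusPairIntegralC n K νA νK W W' Φ s := by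
    intro F
    have hmem : ∀ v ∈ F.map (Function.Embedding.subtype fun v => v ∉ S'), v ∉ S' := fun v hv => by
      obtain ⟨u, -, rfl⟩ := Finset.mem_map.1 hv
      exact u.2
    rw [← prod_torusPairSumC_mul_setIntegral_eq_rankinSelbergTorusPairIntegralC νA νK hn
      (F.map (Function.Embedding.subtype fun v => v ∉ S'))
      (fun v hv => hW v (hmem v hv)) (fun v hv => hW' v (hmem v hv)) hWZ (fun v hv => hΦ v (hmem v hv))
      (fun v hv => hΦv v (hmem v hv)) hΦ0 s hint, Finset.prod_map]
    congr 1
    refine Finset.prod_congr rfl fun u _ => ?_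
    exact (torusPairSumC_eq_inv_eval_satakePairPolynomial (hTx u.1 u.2) (hTy u.1 u.2) (hx u.1 u.2) (hy u.1 u.2)).symm
  have hlim : Tendsto (fun F : Finset {v : HeightOneSpectrum (𝓞 K) // v ∉ S'} =>
      (∏ u ∈ F, ((satakePairPolynomial (α u.1) (β u.1)).eval ((u.1.residueCard : ℂ) ^ (-s)))⁻¹) *
        ∫ p in unitBox (↑(F.map (Function.Embedding.subtype fun v => v ∉ S')) : Set (HeightOneSpectrum (𝓞 K))) ×ˢ Set.univ,
          torusPairIntegrandC n K W W' Φ s p ∂(νA.prod νK)) atTop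
      (𝓝 (L * ∫ p in unitBox {v | v ∉ S'} ×ˢ Set.univ, torusPairIntegrandC n K W W' Φ s p ∂(νA.prod νK))) :=
    Filter.Tendsto.mul hL (tendsto_setIntegral_unitBox_image_pair νA νK S' hint)
  simp_rw [hF] at hlim
  exact tendsto_nhds_unique tendsto_const_nhds hlim

end Limit

end Literature.NumberTheory.Automorphic
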